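import Summits.ResolutionOfSingularities.ResolutionOfSingularities.Theorems.PurelyInseparableDim4SpineGame
import Summits.ResolutionOfSingularities.ResolutionOfSingularities.Theorems.PurelyInseparableDim4Perm2Bound
import HarnessLib

/-!
# [OURS · res-dim4-pi PR-9b] The SUPPORT DICTIONARY at the chart origin: the coordinate-centre walk
  read on supports IS the spine game, so a positional winning strategy of the spine game yields a
  permissible coordinate-centre rule with no infinite spine branch
  (`PositionalWin4 q → SpineTerminatesSomeRule p q`)

Cell `res-dim4-pi` (D-0157 DOOR 2, wave 2), brick **PR-9b** (desk `boards/WAVE2.md` §F, WORDS #22–#24: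
"the support dictionary at `b = 0`"), seat `res-dim4-p-7` (width copy of row PR-1).  Typed over the
TREE: the census frames `PIDim4.SpineTerminatesSomeRule / SpineTerminatesUnder / SpineEdge`
(`PurelyInseparableDim4Scope`), `PIDim4.PositionalWin4 / IsSpinePositionalWin / IsSpinePlay / spineMove
/ pureMove / SpineWon / SpinePermissible` (`PurelyInseparableDim4SpineGame`), `PIDim4.CentreRule /
IsPermissibleRule` (`…Rules`), the model `CentreBlowup.step / chartTransform / chartExponent / ordAlong /
degIn` (`Literature…PointBlowupShadeCentres`), Hauser's `deletePthPowers`, and res-dim4-p-2's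
chart-origin lemmas (`PIDim4.Perm2Bound.*`, `PurelyInseparableDim4Perm2BoundOrigin` / `…Perm2Bound`,
incl. `PIDim4.forall_le_degIn_of_isPermissibleCentre`); nothing is restated.  PR-9a (`PurePositionalWin4 q → PositionalWin4 q`, LEMMA D1) and PR-9c (discharging
`PurePositionalWin4`) are res-dim4-p-10's bricks and are NOT in this file.

## What is proved (every exponent `q`, every field `K`; no cleanliness hypothesis anywhere)

* §1 `support_deletePthPowers` (cleaning deletes exactly the `q`-th-power exponents),
  `support_chartTransform` (under condition (1) the support of the chart transform is the image of the
  support under the chart law), and **THE DICTIONARY** `support_step_origin`: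
  `((step q S j 0 s).F).support = spineMove q S j (s.F).support` whenever `V(z, x_S)` is
  Hironaka-permissible for `z^q + s.F` and `j ∈ S` — the walk read on supports at the chart origin IS
  the spine game's move (pure move, then deletion); coefficients, `r` and `exc` are irrelevant.
* §2 won positions vs permissible centres: `eq_zero_of_spineWon` (a won support with a permissible
  centre is the support of `0`), `not_spineWon_support_iff` (`¬ SpineWon` = "`F ≠ 0` and the origin is
  `q`-fold", i.e. `q ≤ ordAlong univ F`), `step_F_eq_zero` (`F = 0` has only the zero successor),
  `exists_support_eq` (every position is the support of a polynomial).
* §3 SUPPORT-READING RULES.  For a positional strategy `σ` and ANY centre rule `R` with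
  `R s = σ (supp s.F)` whenever `s.F ≠ 0`: an infinite spine branch under `R` reads, on supports, as an
  infinite spine play against `σ` (`isSpinePlay_of_chain`), and CONVERSELY every infinite spine play
  against `σ` lifts to an infinite spine branch under `R` from any state with the right support
  (`exists_chain_of_isSpinePlay` — the chart origin above a not-yet-won position is automatically
  equimultiple and the new `F` is non-zero); hence the EXACT dictionary
  `spineTerminatesUnder_iff_of_agrees : SpineTerminatesUnder q R ↔ ¬ ∃ A, IsSpinePlay q σ A` and
  `isSpinePositionalWin_iff : IsSpinePositionalWin q σ ↔ (σ permissible off won positions) ∧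
  SpineTerminatesUnder q R`; and `isPermissibleRule_of_agrees`.
* §4 **PR-9b** `spineTerminatesSomeRule_of_positionalWin4 : PositionalWin4 q → SpineTerminatesSomeRule
  p q` (the characteristic plays no role), with the rule `s ↦ σ (supp s.F)` (`univ` at `F = 0`).

Scope / honesty: chart origins only (`b = 0`, the census' `t = 0` spine).  [OURS · counted 0 · AI work
weaker than expert review] NOTHING here proves resolution of singularities in dimension ≥ 4 /
characteristic `p`; this is bookkeeping about OUR candidate frame (the coordinate-centre game on
`z^p + F(x₁..x₄)` read at chart origins).  bears_on: LADDER-RESOLUTION:D157-DOOR2 (res-dim4-pi ·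
PR-9b). Supports stmt-ResolutionOfSingularities-16155 (helper).
-/

noncomputable section

set_option linter.dupNamespace false -- mandated namespace of this single-conjunct summit

open MvPolynomial Finset

open scoped BigOperators

namespace Summit.ResolutionOfSingularities.ResolutionOfSingularities.Theorems.PIDim4

namespace SpineDictionary

open Literature.AlgebraicGeometry.Resolution
open Literature.AlgebraicGeometry.Resolution.CentreBlowup
open Literature.AlgebraicGeometry.Resolution.Hauser2010

/-! ## §1 Supports: cleaning, the chart transform, the step at the chart origin -/

section Support

variable {σ : Type*} {K : Type*} [Field K] [DecidableEq σ]

/-- **Cleaning read on supports**: deleting the `q`-th-power monomials keeps exactly the monomials whose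
exponent is not a `q`-th-power exponent. [folklore] -/
theorem support_deletePthPowers (q : ℕ) (P : MvPolynomial σ K) :
    (deletePthPowers q P).support = P.support.filter fun d => ¬ IsPthPowerExponent q d := by
  ext d
  rw [Finset.mem_filter, MvPolynomial.mem_support_iff, MvPolynomial.mem_support_iff,
    coeff_deletePthPowers]
  by_cases h : IsPthPowerExponent q d
  · rw [if_pos h]
    exact ⟨fun h0 => (h0 rfl).elim, fun h' => (h'.2 h).elim⟩
  · rw [if_neg h]
    exact ⟨fun h0 => ⟨h0, h⟩, fun h' => h'.1⟩

/-- **The chart transform read on supports** under condition (1) (`j ∈ S`, `q ≤ degIn S e` on the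
support): its support is the image of the support under the chart law `chartExponent q S j` (no two
monomials collide, no coefficient is lost). [folklore] -/
theorem support_chartTransform {q : ℕ} {S : Finset σ} {j : σ} (hj : j ∈ S)
    {F : MvPolynomial σ K} (hq : ∀ e ∈ F.support, q ≤ degIn S e) :
    (chartTransform q S j F).support = F.support.image (chartExponent q S j) := by
  ext E
  rw [Finset.mem_image]
  constructor
  · intro hE
    exact Perm2Bound.exists_of_mem_support_chartTransform q S j F hE
  · rintro ⟨e, he, rfl⟩
    exact (Perm2Bound.mem_support_chartTransform_iff hj hq (hq e he)).mpr he

end Support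

section Dim4

variable {K : Type} [Field K] [DecidableEq K]

-- Condition (1) monomialwise (`IsPermissibleCentre q S F → ∀ e ∈ F.support, q ≤ degIn S e`) is
-- res-dim4-p-2's `PIDim4.forall_le_degIn_of_isPermissibleCentre` (`PurelyInseparableDim4Perm2Bound`),
-- imported and used below, not restated.

/-- **THE SUPPORT DICTIONARY at the chart origin.** For a Hironaka-permissible coordinate centre
`V(z, x_S)` of `z^q + F` and a chart `j ∈ S`, the support of the new residual polynomial at the chart
ORIGIN (`b = 0`: chart transform, trivial translation, cleaning) is the spine game's move applied to the
support of `F`: pure move `e ↦ chartExponent q S j e`, then deletion of the `q`-divisible points.  No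
cleanliness of `F` is needed; the multiplicities `r` and the components `exc` play no role. [folklore] -/
theorem support_step_origin {q : ℕ} {S : Finset (Fin 4)} {j : Fin 4} (hj : j ∈ S) (s : State K)
    (hS : IsPermissibleCentre q S s.F) :
    (CentreBlowup.step q S j (0 : Fin 4 → K) s).F.support = spineMove q S j s.F.support := by
  show (deletePthPowers q
      (PointBlowup.translate (0 : Fin 4 → K) (chartTransform q S j s.F))).support = _
  rw [PointBlowup.translate_eq_self (0 : Fin 4 → K) (fun _ => rfl), support_deletePthPowers,
    support_chartTransform hj (forall_le_degIn_of_isPermissibleCentre hS)]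
  unfold spineMove pureMove
  exact Finset.filter_congr fun d _ => by rw [isPthPowerExponent_iff]

omit [DecidableEq K] in
/-- The pre-cleaning transform at the chart origin read on supports: the pure move. [folklore] -/
theorem support_pointTransform_origin {q : ℕ} {S : Finset (Fin 4)} {j : Fin 4} (hj : j ∈ S)
    (s : State K) (hS : IsPermissibleCentre q S s.F) :
    (CentreBlowup.pointTransform q S j (0 : Fin 4 → K) s).support = pureMove q S j s.F.support := by
  show (PointBlowup.translate (0 : Fin 4 → K) (chartTransform q S j s.F)).support = _
  rw [PointBlowup.translate_eq_self (0 : Fin 4 → K) (fun _ => rfl),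
    support_chartTransform hj (forall_le_degIn_of_isPermissibleCentre hS)]
  rfl

/-! ## §2 Won positions versus permissible centres; every position is a support -/

omit [DecidableEq K] in
/-- A support at which player A has already WON (empty, or a monomial of degree `< q`) admits a
permissible coordinate centre only if `F = 0` (then every non-empty `S` is permissible, `ordAlong S 0 = ⊤`).
[folklore] -/
theorem eq_zero_of_spineWon {q : ℕ} {S : Finset (Fin 4)} {F : MvPolynomial (Fin 4) K}
    (hwon : SpineWon q F.support) (hS : IsPermissibleCentre q S F) : F = 0 := by
  rcases hwon with h | ⟨a, ha, hlt⟩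
  · exact MvPolynomial.support_eq_empty.mp h
  · exfalso
    have h1 := forall_le_degIn_of_isPermissibleCentre hS a ha
    have h2 := degIn_le_degree S a
    omega

omit [DecidableEq K] in
/-- `¬ SpineWon` read on the polynomial: `F ≠ 0` and the origin is a `q`-fold point of `z^q + F`
(`q ≤ ordAlong univ F`, the guard of `Step0` / `IsTrap`). [folklore] -/
theorem not_spineWon_support_iff (q : ℕ) (F : MvPolynomial (Fin 4) K) :
    ¬ SpineWon q F.support ↔ F ≠ 0 ∧ (q : ℕ∞) ≤ ordAlong Finset.univ F := by
  unfold SpineWon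
  rw [not_or, Ne, MvPolynomial.support_eq_empty, le_ordAlong_iff]
  refine and_congr Iff.rfl ⟨fun h d hd => ?_, fun h => ?_⟩
  · rw [degIn_univ]
    exact_mod_cast not_lt.mp fun hlt => h ⟨d, hd, hlt⟩
  · rintro ⟨a, ha, hlt⟩
    have := h a ha
    rw [degIn_univ] at this
    exact not_lt.mpr (by exact_mod_cast this) hlt

/-- The zero residual polynomial has only zero successors (so `F = 0` is terminal for `Edge` /
`SpineEdge`, which require a non-zero new `F`). [folklore] -/
theorem step_F_eq_zero {q : ℕ} {S : Finset (Fin 4)} {j : Fin 4} {b : Fin 4 → K} (s : State K)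
    (h : s.F = 0) : (CentreBlowup.step q S j b s).F = 0 := by
  show deletePthPowers q (PointBlowup.translate b (chartTransform q S j s.F)) = 0
  rw [h, chartTransform_zero]
  unfold PointBlowup.translate
  rw [map_zero, deletePthPowers_zero]

omit [DecidableEq K] in
/-- Every position of the spine game is the support of a polynomial (all coefficients `1`).
[folklore] -/
theorem exists_support_eq (A : SpinePos) : ∃ F : MvPolynomial (Fin 4) K, F.support = A := by
  refine ⟨∑ a ∈ A, monomial a (1 : K), ?_⟩
  ext d
  rw [MvPolynomial.mem_support_iff, coeff_sum]
  simp only [coeff_monomial, Finset.sum_ite_eq']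
  split_ifs with h
  · exact ⟨fun _ => h, fun _ => one_ne_zero⟩
  · exact ⟨fun h1 => (h1 rfl).elim, fun h' => (h h').elim⟩

/-! ## §3 Support-reading rules: the dictionary between spine branches and spine plays -/

/-- **A support-reading rule is permissible.** If `σ` is permissible at every position not yet won
and the centre rule `R` reads `σ` off the support of every non-zero `F` (any non-empty centre at
`F = 0`), then `R` picks a Hironaka-permissible centre whenever one exists. [folklore] -/
theorem isPermissibleRule_of_agrees (q : ℕ) (σ : SpineStrategy)
    (hσ : ∀ A, ¬ SpineWon q A → SpinePermissible q (σ A) A) {R : CentreRule K}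
    (hR : ∀ s : State K, s.F ≠ 0 → R s = σ s.F.support)
    (hR0 : ∀ s : State K, s.F = 0 → (R s).Nonempty) : IsPermissibleRule q R := by
  intro s hs
  by_cases hF : s.F = 0
  · refine ⟨hR0 s hF, ?_⟩
    rw [hF, ordAlong_zero]
    exact le_top
  · rw [hR s hF]
    have hnw : ¬ SpineWon q s.F.support := fun hw => by
      obtain ⟨S, hS⟩ := hs
      exact hF (eq_zero_of_spineWon hw hS)
    exact (spinePermissible_support_iff q _ s.F).mp (hσ _ hnw)

/-- **Branch ⇒ play.** An infinite spine branch under a support-reading rule reads, on supports, as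
an infinite spine play against `σ`. [folklore] -/
theorem isSpinePlay_of_chain (q : ℕ) (σ : SpineStrategy) {R : CentreRule K}
    (hR : ∀ s : State K, s.F ≠ 0 → R s = σ s.F.support) (c : ℕ → State K)
    (hc : ∀ k, IsPermissibleCentre q (R (c k)) (c k).F ∧ SpineEdge q (R (c k)) (c k) (c (k + 1))) :
    IsSpinePlay q σ fun k => (c k).F.support := by
  intro k
  obtain ⟨hperm, j, hj, -, hne, heq⟩ := hc k
  have hF : (c k).F ≠ 0 := fun h0 => hne (step_F_eq_zero (c k) h0)
  rw [hR _ hF] at hperm hj heq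
  have hnw : ¬ SpineWon q (c k).F.support := fun hw => hF (eq_zero_of_spineWon hw hperm)
  refine ⟨hnw, j, hj, ?_⟩
  show (c (k + 1)).F.support = spineMove q (σ (c k).F.support) j (c k).F.support
  rw [heq]
  exact support_step_origin hj (c k) hperm

/-- **The chart origin above a not-yet-won move is equimultiple.** If `V(z, x_S)` is permissible,
`j ∈ S`, and the spine move of the support is not a won position, then the origin of the `x_j`-chart
is an equimultiple point: a monomial of the (pre-cleaning) transform of degree `< q` is either
`q`-divisible — impossible for a non-zero exponent of degree `< q` — or survives the deletion and
would win the next position. [folklore] -/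
theorem isEquimultiplePoint_origin_of_not_spineWon {q : ℕ} {S : Finset (Fin 4)} {j : Fin 4}
    (hj : j ∈ S) (s : State K) (hS : IsPermissibleCentre q S s.F)
    (hnw : ¬ SpineWon q (spineMove q S j s.F.support)) :
    CentreBlowup.IsEquimultiplePoint q S j (0 : Fin 4 → K) s := by
  intro d hd0 hdeg
  by_contra hne
  have hmem : d ∈ pureMove q S j s.F.support := by
    rw [← support_pointTransform_origin hj s hS]
    exact MvPolynomial.mem_support_iff.mpr hne
  by_cases hdvd : ∀ i, q ∣ d i
  · obtain ⟨i, hi⟩ := Finsupp.support_nonempty_iff.mpr hd0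
    have hi' : d i ≠ 0 := Finsupp.mem_support_iff.mp hi
    have hqi : q ≤ d i := Nat.le_of_dvd (Nat.pos_of_ne_zero hi') (hdvd i)
    have hle : d i ≤ d.degree := Finsupp.le_degree i d
    omega
  · apply hnw
    right
    refine ⟨d, ?_, hdeg⟩
    unfold spineMove
    exact Finset.mem_filter.mpr ⟨hmem, hdvd⟩

/-- **Play ⇒ branch.** Every infinite spine play against `σ` (with `σ` permissible off won positions)
lifts, from ANY state `s₀` whose residual polynomial has the initial position as support, to an
infinite spine branch under any support-reading rule `R`: the `k`-th state has support `A k`, the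
centre `R (c k) = σ (A k)` is permissible, the chart origin is equimultiple and the new `F` is
non-zero. [folklore] -/
theorem exists_chain_of_isSpinePlay (q : ℕ) (σ : SpineStrategy)
    (hσ : ∀ A, ¬ SpineWon q A → SpinePermissible q (σ A) A) {R : CentreRule K}
    (hR : ∀ s : State K, s.F ≠ 0 → R s = σ s.F.support) {A : ℕ → SpinePos}
    (hA : IsSpinePlay q σ A) (s₀ : State K) (h0 : s₀.F.support = A 0) :
    ∃ c : ℕ → State K, c 0 = s₀ ∧ ∀ k, (c k).F.support = A k ∧
      IsPermissibleCentre q (R (c k)) (c k).F ∧ SpineEdge q (R (c k)) (c k) (c (k + 1)) := by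
  choose j hj hsucc using fun k => (hA k).2
  let c : ℕ → State K := fun k =>
    Nat.rec s₀ (fun k s => CentreBlowup.step q (σ (A k)) (j k) (0 : Fin 4 → K) s) k
  have hcs : ∀ k, c (k + 1) = CentreBlowup.step q (σ (A k)) (j k) (0 : Fin 4 → K) (c k) :=
    fun k => rfl
  -- permissibility of `σ (A k)` at any state with support `A k`
  have hpermOf : ∀ k (s : State K), s.F.support = A k → IsPermissibleCentre q (σ (A k)) s.F := by
    intro k s hs
    have h1 : SpinePermissible q (σ (A k)) s.F.support := by
      rw [hs]
      exact hσ _ (hA k).1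
    exact (spinePermissible_support_iff q _ s.F).mp h1
  -- the supports along the lifted branch are the positions of the play
  have hsupp : ∀ k, (c k).F.support = A k := by
    intro k
    induction k with
    | zero => exact h0
    | succ k ih =>
      rw [hcs, hsucc k, support_step_origin (hj k) (c k) (hpermOf k (c k) ih), ih]
  refine ⟨c, rfl, fun k => ?_⟩
  have hnw : ¬ SpineWon q (A k) := (hA k).1
  have hF : (c k).F ≠ 0 := fun hz => by
    apply hnw
    left
    rw [← hsupp k, hz, MvPolynomial.support_zero]
  have hperm : IsPermissibleCentre q (σ (A k)) (c k).F := hpermOf k (c k) (hsupp k)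
  have hRk : R (c k) = σ (A k) := by rw [hR _ hF, hsupp k]
  refine ⟨hsupp k, hRk ▸ hperm, ?_⟩
  rw [hRk]
  refine ⟨j k, hj k, ?_, ?_, hcs k⟩
  · apply isEquimultiplePoint_origin_of_not_spineWon (hj k) (c k) hperm
    rw [hsupp k, ← hsucc k]
    exact (hA (k + 1)).1
  · intro hz
    apply (hA (k + 1)).1
    left
    rw [← hsupp (k + 1), hcs k, hz, MvPolynomial.support_zero]

/-- **THE EXACT DICTIONARY for a fixed strategy.** For `σ` permissible off won positions and any
support-reading rule `R` agreeing with `σ`: `R` has no infinite spine branch iff `σ` admits no infinite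
spine play. [folklore] -/
theorem spineTerminatesUnder_iff_of_agrees (q : ℕ) (σ : SpineStrategy)
    (hσ : ∀ A, ¬ SpineWon q A → SpinePermissible q (σ A) A) {R : CentreRule K}
    (hR : ∀ s : State K, s.F ≠ 0 → R s = σ s.F.support) :
    SpineTerminatesUnder q R ↔ ¬ ∃ A : ℕ → SpinePos, IsSpinePlay q σ A := by
  constructor
  · rintro hT ⟨A, hA⟩
    obtain ⟨F, hF⟩ := exists_support_eq (K := K) (A 0)
    obtain ⟨c, -, hc⟩ := exists_chain_of_isSpinePlay q σ hσ hR hA ⟨F, 0, ∅⟩ hF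
    exact hT ⟨c, fun k => (hc k).2⟩
  · rintro hP ⟨c, hc⟩
    exact hP ⟨fun k => (c k).F.support, isSpinePlay_of_chain q σ hR c hc⟩

/-- **Positional win = spine termination of the induced rule** (over any one field): `σ` wins the
spine game from every position iff it is permissible off won positions and some (equivalently every)
support-reading rule agreeing with it has no infinite spine branch. [folklore] -/
theorem isSpinePositionalWin_iff (q : ℕ) (σ : SpineStrategy) {R : CentreRule K}
    (hR : ∀ s : State K, s.F ≠ 0 → R s = σ s.F.support) :
    IsSpinePositionalWin q σ ↔
      (∀ A, ¬ SpineWon q A → SpinePermissible q (σ A) A) ∧ SpineTerminatesUnder q R := by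
  unfold IsSpinePositionalWin
  exact and_congr_right fun hσ => (spineTerminatesUnder_iff_of_agrees q σ hσ hR).symm

/-! ## §4 PR-9b: a positional win of the spine game gives a spine-terminating permissible rule -/

/-- **PR-9b (desk WORD #23 (b) / #24).** A positional winning strategy of the spine game with
deletions in four variables yields, over every field, a permissible coordinate-centre rule with no
infinite spine branch: `PositionalWin4 q → SpineTerminatesSomeRule p q` (the characteristic plays no
role; the rule is `s ↦ σ (supp s.F)`, and the point `univ` at `F = 0`). [OURS · counted 0] [folklore] -/
theorem spineTerminatesSomeRule_of_positionalWin4 (p q : ℕ) (h : PositionalWin4 q) :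
    SpineTerminatesSomeRule p q := by
  intro K _ _ _
  obtain ⟨σ, hσperm, hσwin⟩ := h
  have hR : ∀ s : State K, s.F ≠ 0 →
      (fun s : State K => if s.F = 0 then (Finset.univ : Finset (Fin 4)) else σ s.F.support) s
        = σ s.F.support := fun s hs => by
    dsimp only
    rw [if_neg hs]
  have hR0 : ∀ s : State K, s.F = 0 →
      ((fun s : State K => if s.F = 0 then (Finset.univ : Finset (Fin 4)) else σ s.F.support) s).Nonempty :=
    fun s hs => by
    dsimp only
    rw [if_pos hs]
    exact Finset.univ_nonempty
  exact ⟨fun s => if s.F = 0 then Finset.univ else σ s.F.support,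
    isPermissibleRule_of_agrees q σ hσperm hR hR0,
    (spineTerminatesUnder_iff_of_agrees q σ hσperm hR).mpr hσwin⟩

end Dim4

end SpineDictionary

end Summit.ResolutionOfSingularities.ResolutionOfSingularities.Theorems.PIDim4

end
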